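import Mathlib
import HarnessLib
import HarnessLib.Audit
import Summits.ABC.Statement
import HarnessLib.Audit.Status.Attr

/-!
Route: LopsidedSzpiroSplit

# Route LopsidedSzpiroSplit — abc splits at the power scale c^(1-ε) into lopsided abc plus sextic
Szpiro for the Frey 2-isogeny codomain

It suffices to show X = X1 ∧ X2 where X1 = LopsidedABC: the abc inequality c < K(ε)·rad(abc)^(1+ε)
for the
LOPSIDED triples only, min(a,b) ≤ c^(1−ε) (the threshold is tied to the target ε); and X2 =
SexticABC: for every
ε > 0 there is K with a·b·c⁴ < K·rad(abc)^(6+ε) for EVERY abc triple — Szpiro's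
discriminant–conductor inequality
with exponent 6+ε for the 2-isogenous codomain E′ of the Frey curve (Δ(E′) = −2⁸·a·b·c⁴, N(E′) |
2⁸·rad), written in
elementary currency. The glue is kernel-checked: with δ = min(ε,1), a balanced triple (min >
c^(1−δ)) has
a·b·c⁴ > c^(6−δ)/2, so X2 at δ gives c^(6−δ) < 2K·rad^(6+δ), i.e. quality < (6+δ)/(6−δ) ≤ 1+ε; a
lopsided one is X1
at δ. Realises the passed markdown-first sketch ABC/lopsided-szpiro-split (no idea card exists for
it).
Lean: `(∀ ε : ℝ, 0 < ε → ∃ K : ℝ, 0 < K ∧ ∀ a b c : ℕ,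
Literature.NumberTheory.DiophantineGeometry.IsABCTriple a b c → ((min a b : ℕ) : ℝ) ≤ (c : ℝ) ^ (1 -
ε) → (c : ℝ) < K * ((Literature.NumberTheory.DiophantineGeometry.rad a b c : ℕ) : ℝ) ^ (1 + ε)) ∧ (∀
ε : ℝ, 0 < ε → ∃ K : ℝ, 0 < K ∧ ∀ a b c : ℕ, Literature.NumberTheory.DiophantineGeometry.IsABCTriple
a b c → ((a * b * c ^ 4 : ℕ) : ℝ) < K * ((Literature.NumberTheory.DiophantineGeometry.rad a b c : ℕ)
: ℝ) ^ (6 + ε))`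

## Assembly
Pure real-exponent bookkeeping, kernel-checked in glue.lean (`closes`, 0 sorry, axioms
propext/choice/Quot.sound):
fix ε, put δ = min(ε,1), take K₁ from LopsidedABC at δ and K₂ from SexticABC at δ, K = max(K₁,
2K₂+1); for a triple
with min(a,b) ≤ c^(1−δ) use K₁ and rad^(1+δ) ≤ rad^(1+ε); otherwise a·b ≥ min·max > c^(1−δ)·c/2, so
c^(6−δ) < 2K₂·rad^(6+δ) and c < (2K₂)^(1/(6−δ))·rad^((6+δ)/(6−δ)) ≤ (2K₂+1)·rad^(1+ε) because
(6+δ)/(6−δ) ≤ 1+2δ/5 ≤ 1+ε.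
`closes` proves the Assembly statement inline and applies it to its two crux hypotheses.

Rationale: WHY THIS LINE. Every printed "Szpiro ⇒ weak abc" loses a factor because Δ(Frey) = 2⁴(abc)² only sees
c squared; the 2-isogenous
codomain E′ has Δ(E′) = −2⁸·a·b·c⁴ (SilvermanAEC2009 Ex. 8.20), so Szpiro(6+ε) for E′ bounds a·b·c⁴,
and this is
EXACTLY abc-strength on the balanced triples (a·b ≳ c^(2−δ)) while saying little on lopsided ones —
the mirror image
of the transcendence side, where linear forms in logarithms do exponentially better precisely when
min(a,b) ≤ c^(1−η)
(Pasten2024 Thm 1.4(1): log c ≤ η⁻¹·exp(κ√(log R·log₂R)); StewartYu2001 gives only R^(1/3)(log R)³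
in general). The
route imports arithmetic geometry of elliptic curves (Szpiro for an explicit isogeny class) for one
cell and
Baker's method + Shimura-curve valuation products (Pasten2024 Thm 2.5) for the other, and glues them
at the
ε-dependent power scale c^(1−ε), where the exponent bookkeeping (6+δ)/(6−δ) ≤ 1+ε closes with room
to spare.
Unlike route CongruentialReceptacle (balanced Szpiro for E at a COMPACT scale κ·c plus a transfer
CRUX) the transfer
here is a proved theorem (`closes`), the scale is a power of c, and the Szpiro cell is the isogenous
curve; unlike
NegOmegaAtlas the lopsided cell is thesis-side, not a negation-side family; the negatives index
(stmt-ABC-1205,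
stmt-ABC-1689) is not touched.

RANKED CRUXES. #2 LopsidedABC (crux) — abc for LOPSIDED triples: for every ε > 0 there is K > 0 such
that every abc triple (a, b, c) with min(a,b) ≤ c^(1−ε) satisfies c < K·rad(abc)^(1+ε) (sketch item
X1; deciding crux). [difficulty: XL] (why it might fail: the lopsided class carries ALL known
extremal abc data (a = 1, c = 3^(2^n); Reyssat's 2 + 3¹⁰·109 = 23⁵) and its only engine, log-forms,
is capped at log c ≤ η⁻¹exp(κ√(log R log₂R)) on exactly this domain (Pasten2024 Thm 1.4(1));
polynomial needs a new input.) [Pasten2024, StewartYu2001, BakerWustholz2007, Baker2004,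
EvertseGyory2015]
#3 SexticABC (crux) — for every ε > 0 there is K > 0 with a·b·c⁴ < K·rad(abc)^(6+ε) for every abc
triple — Szpiro's conjecture with exponent 6+ε for the 2-isogenous codomain E′ : y² = x³ − 2(a−b)x²
+ c²x of the Frey curve (Δ = −2⁸·a·b·c⁴, multiplicative at odd p | abc), in elementary currency
(sketch item X2). [difficulty: XL] (why it might fail: it is Szpiro(6+ε) on an explicit infinite
isogeny-class family — conjecture-grade: no unconditional polynomial bound |Δmin| ≪ N^k is known for
any non-isotrivial family over ℚ (log-forms give only exponential Szpiro); ε = 0 is false in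
Weierstrass currency (Masser2002).) [SilvermanAEC2009, Masser2002, Oesterle1988, StewartYu2001]

TWO-LAYER PLAN. Foreseen glued splits (birth skeletons checked, glue proved, nothing filed now):
LopsidedABC ⇐ FewPrimeCoincidence →
ManyPrimeCoincidence → LopsidedABC, the cells being ω(c·max(a,b)) ≤ k₀ / > k₀ (the only cell
structure invariant under
the power maps (maxʲ, cʲ − maxʲ, cʲ) that make every archimedean / ω(abc) / squarefree-c cell
X1-complete); SexticABC ⇐
SzpiroPrime (Szpiro(6+ε) for (freyCurve a b).twoIsogenyCodomain in
minimalDiscriminantNorm/conductorNorm currency) →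
PrimeLocalData (a·b·c⁴ ≤ 2²⁸·|Δmin(E′)|, N(E′) ≤ 2⁸·rad; SilvermanAEC2009 Ex. 8.20(b), provable now)
→ SexticABC.

KILL CRITERIA. Either crux is implied by ABC (Sketch.lean: lopsided_of_abc, sextic_of_abc), so a
refutation of LopsidedABC or of
SexticABC is a refutation of ABC itself — close `refuted:<Decl>` and hand the witness to the
negation routes
(NegOmegaAtlas). The route-specific kill is the COSTUME test: an elementary quality-preserving
transfer from all (or
all balanced) abc triples INTO the lopsided class (making LopsidedABC ⟺ ABC cheaply) empties the
split — close
`superseded`; Mason–Stothers rules out every POLYNOMIAL identity (bred triples have quality → 1), so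
the refuter's search
is over non-polynomial transfers. If CongruentialReceptacle's BalancedFreySzpiro +
CompactBalanceTransfer close, ABC is
proved and this route is moot; if SzpiroPrime is shown to need full Szpiro (no use of the
c⁴-weighting), SexticABC is
re-ranked 2 and the route pivots to the lopsided cell as its only owned content.

NOT DECOMPOSED YET. The threshold k₀ in the ω(c·max(a,b)) split and the constants 2²⁸, 2⁸ (layer-2
children, skeleton stubs); the Szpiro
input for E′ (modular degree / Faltings height / level structure — whichever the SexticABC crux
chain picks); any
quantitative use of Pasten's Shimura-curve valuation product (pasten2024_thm_2_5) beyond the BC5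
rung; the a = 1
sub-family (c − 1 smooth) as a separate rung. None of these is an item at open (D-0019: two layers,
earned later).

CHEAPEST FALSIFIER. (i) Lookup, run: is "abc restricted to a ≤ c^(1−η)" known to be elementarily
EQUIVALENT to abc? — no such transfer in
Pasten2024 (the lopsided case is proved separately and the split at √c, p. 9, treats the balanced
half by other means),
BakerWustholz2007 §3.7 or EvertseGyory2015 §4.6; and no POLYNOMIAL identity can give one: by
Mason–Stothers a breeding
identity of degree n ≥ 2 multiplies the radical by new factors of size ≍ c^(n−1) up to the old
radical, so bred triples
have quality ≤ nq/(n−1+q) → 1 (squaring: 2q/(1+q)) — quality is not transported into the lopsided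
class. Survives.
(ii) Data, for the refuter (one kit job): in the ABC@home / de Smit list of triples with quality >
1.4 tabulate
s = log min(a,b)/log c; finitely many triples cannot refute an ∃K statement, but if high quality
concentrates at s → 1
(balanced) rather than at small s, the rationale "the lopsided cell carries the extremal data" is
wrong and SexticABC,
not LopsidedABC, is the deciding crux (re-rank, not a kill). (iii) The decisive kill of either crux
is a disproof of ABC.

NUMBERS. All-triples ceiling: log c ≤ κ·R^(1/3)(log R)³ (StewartYu2001; EvertseGyory2015 p. 88;
BakerWustholz2007 p. 51).
Lopsided domain a ≤ c^(1−η): log c ≤ η⁻¹·exp(κ√(log R·log₂R)) (Pasten2024 Thm 1.4(1), Invent. Math.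
236; formalised as
Literature.Barriers.ABC.pasten2024_thm_1_4_1_holds_of). Frey side: Δ(E) = 2⁴(abc)² ⇒ Szpiro gives
exponent 3/2
(SilvermanAEC2009 VIII.11.5a, p. 223); Δ(E′) = −2⁸abc⁴, |Δmin(E′)| ≥ 2⁻²⁸·abc⁴ ⇒ exponent 6/5 on all
triples
(Ex. 8.20, p. 230) and 1+ε on the balanced cell (this route). Record quality 1.6299 (2 + 3¹⁰·109 =
23⁵) is lopsided
(min = 2). Items at open: 3 (2 cruxes + assembly).

DEFINITION REQUESTS. None: IsABCTriple, rad (Literature.NumberTheory.DiophantineGeometry, AbcWave0),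
freyCurve / twoIsogenyCodomain /
minimalDiscriminantNorm / conductorNorm (Literature.NumberTheory.EllipticCurves) all exist; the
cruxes use only the first two.

Novelty: Searches (2026-08-17): `lit search --hybrid "abc conjecture small a subexponential bound linear
forms in logarithms"` (Pasten2024 p.2, held); `lit search "Szpiro isogenous curve discriminant abc
exponent 6/5"` (SilvermanAEC2009 p.230, held); `lit vsearch "abc inequality restricted to triples
with one very small member"` (Pasten2024, StewartYu); `lit galaxy search "abc conjecture" --star
panama --title-contains Diophantine` (7 books: Evertse–Győry ×2, Bombieri–Gubler, Lang, Sprindzuk,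
Steuding, Vojta); `lit galaxy search … --mode bm25 --star pdf "best unconditional bound towards the
abc conjecture … Stewart Yu subexponential small a"` (hit 1 = pdf:7635303352151822420 = Pasten2024);
`lit galaxy search "2-isogenous|Szpiro ratio|Szpiro's conjecture implies" --star all` (0 relevant);
`"exponent 6/5|abc conjecture with exponent|weak abc" --star pdf` (0 relevant); `lean search` /
dedup `exact?` against all 27 ABC Theses + ABC Literature (no match); `ledger negatives --problem
ABC` (2, unrelated).
Nearest prior art found: Pasten2024 (arXiv:2312.03566) p. 9 — "By Theorem 1.4 item (1) it suffices
to assume c^(1/2) ≤ a < b < c": a lopsided/balanced split at √c with BOTH halves treated by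
log-forms (the balanced half keeps the factor q = min P(·)); SilvermanAEC2009 Ex. 8.20 — Szpiro(E′)
⇒ abc exponent 6/5 with no complement; in-tree route CongruentialReceptacle (BalancedFreySzpiro
stmt-ABC-1723 at compact scale κc, transfer as crux stmt-ABC-1725) and NegOmegaAtlas
(UnbalancedFamily stmt-  [refs: 2312.03566, Pasten2024, SilvermanAEC2009]

Barriers (technique_class: regime-split, log-forms, szpiro-frey-isogeny): - technique_class: regime-split, log-forms, szpiro-frey-isogeny
- Literature.Barriers.ABC.BakerMethodBounds: LopsidedABC's natural attack sits INSIDE this class and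
the barrier is a ceiling theorem (Stewart–Yu R^(1/3)(log R)³; on the lopsided domain Pasten's
exp(κ√(log R log₂R)), formalised in BakerMethodBoundsPastenDecomposition) — it is not evaded; the
bet is that the lopsided hypothesis (archimedean smallness |log(max/c)| ≤ 2c^(−ε)) plus the
Shimura-curve valuation product for the many-prime cell is where a polynomial bound is least out of
reach, and the ceiling-lift (a Baker Ξ-type simultaneous estimate, BakerWustholz2007 §3.7) is named
in BC9. SexticABC sits OUTSIDE the class (modular / arithmetic-geometric Szpiro input).
- Literature.Barriers.ABC.EpsilonCannotBeDropped: both cruxes keep ε > 0 with K = K(ε); the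
Granville–Tucker family a = 1, c = 3^(2^n) is lopsided and has quality → 1, consistent with
LopsidedABC.
- Literature.Barriers.ABC.SzpiroEpsilonCannotBeDropped: SexticABC keeps 6+ε and K(ε); Masser's
semistable polylog-excess curves refute only ε = 0.
- Literature.Barriers.ABC.HallExponentSharp: Hall/Danilov triples (y², k, x³) with k ≍ x^(1/2) are
LOPSIDED (min ≍ c^(1/6)) and have quality → 1, so they sit inside LopsidedABC's hypothesis and are
absorbed by K(ε); for SexticABC they give a·b·c⁴ ≍ c^(31/6) against rad⁶ ≍ c⁶ — consistent. The
barrier (exponent 1/2 sharp) is not quantified over either crux.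
- Literature.Barriers.ABC.ExplicitABCQualityFloor / UniformA

History (route lifecycle, newest last):
- 2026-08-27T16:49:18Z · DORMANT — reconciler: no traction for 9.9 d (last activity item-evidence-added at 2026-08-17T19:03:48Z); parked, not closed — `ledger route dormant route-ABC-LopsidedSzpi (operator:999:3856977)
- 2026-08-30T09:59:36Z · REACTIVATED — reconciler: reactivated — activity item-evidence-added at 2026-08-30T09:14:31Z after parking at 2026-08-27T16:49:18Z (operator:999:2646876)

sub-problem: ABC · status: open · opened planner-type-2a0d0ec4e7-0 2026-08-17T15:57:25Z · rev 0 · ledger route-ABC-LopsidedSzpiroSplit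
GENERATED by the gate from the ledger (D-0016/17). Provers cite these decls: `theorem foo : Summit.ABC.ABC.Theses.LopsidedSzpiroSplit.<Decl> := …` in Summits/ABC/ABC/Theorems/<Name>.lean.
-/

namespace Summit.ABC.ABC.Theses.LopsidedSzpiroSplit

open scoped BigOperators Topology Manifold Classical MeasureTheory ProbabilityTheory Matrix InnerProductSpace ComplexConjugate ContinuousMap
open Filter Set Function TopologicalSpace MeasureTheory

attribute [summit_statement] _root_.ABC

open Literature.Abc

/-- item stmt-ABC-18360 · crux · rank 2 · open · by planner
why it might fail: the lopsided class carries ALL known extremal abc data (a = 1, c = 3^(2^n); Reyssat's 2 + 3¹⁰·109 = 23⁵) and its only engine, log-forms, is capped at log c ≤ η⁻¹exp(κ√(log R log₂R)) on exactly this domain (Pasten2024 Thm 1.4(1)); polynomial needs a new input.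
sources: Pasten2024, StewartYu2001, BakerWustholz2007, Baker2004, EvertseGyory2015
[crux] abc for LOPSIDED triples: for every ε > 0 there is K > 0 such that every abc triple (a, b, c)
with min(a,b) ≤ c^(1−ε) satisfies c < K·rad(abc)^(1+ε) (sketch item X1; deciding crux). [difficulty:
XL] -/
@[route_item "route-ABC-LopsidedSzpiroSplit", crux]
def LopsidedABC : Prop :=
  ∀ ε : ℝ, 0 < ε → ∃ K : ℝ, 0 < K ∧ ∀ a b c : ℕ, Literature.NumberTheory.DiophantineGeometry.IsABCTriple a b c → ((min a b : ℕ) : ℝ) ≤ (c : ℝ) ^ (1 - ε) → (c : ℝ) < K * ((Literature.NumberTheory.DiophantineGeometry.rad a b c : ℕ) : ℝ) ^ (1 + ε)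

/-- item stmt-ABC-18361 · crux · rank 3 · open · by planner
why it might fail: it is Szpiro(6+ε) on an explicit infinite isogeny-class family — conjecture-grade: no unconditional polynomial bound |Δmin| ≪ N^k is known for any non-isotrivial family over ℚ (log-forms give only exponential Szpiro); ε = 0 is false in Weierstrass currency (Masser2002).
sources: SilvermanAEC2009, Masser2002, Oesterle1988, StewartYu2001
[crux] for every ε > 0 there is K > 0 with a·b·c⁴ < K·rad(abc)^(6+ε) for every abc triple — Szpiro's
conjecture with exponent 6+ε for the 2-isogenous codomain E′ : y² = x³ − 2(a−b)x² + c²x of the Frey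
curve (Δ = −2⁸·a·b·c⁴, multiplicative at odd p | abc), in elementary currency (sketch item X2).
[difficulty: XL] -/
@[route_item "route-ABC-LopsidedSzpiroSplit", crux]
def SexticABC : Prop :=
  ∀ ε : ℝ, 0 < ε → ∃ K : ℝ, 0 < K ∧ ∀ a b c : ℕ, Literature.NumberTheory.DiophantineGeometry.IsABCTriple a b c → ((a * b * c ^ 4 : ℕ) : ℝ) < K * ((Literature.NumberTheory.DiophantineGeometry.rad a b c : ℕ) : ℝ) ^ (6 + ε)

/-- item stmt-ABC-18362 · assembly · rank 1 · open · by planner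
sources: SilvermanAEC2009, Pasten2024
[assembly] LopsidedABC → SexticABC → ABC. -/
@[route_item "route-ABC-LopsidedSzpiroSplit"]
def Assembly : Prop :=
  LopsidedABC → SexticABC → _root_.ABC

/-! D-0027 §2.1 — DECIDING THEOREM (planner-authored via `route open/edit --closes-file`; by planner-type-2a0d0ec4e7-0 2026-08-17T15:57:25Z):
its hypotheses are this route's items and its conclusion the sub-problem Statement (glue_lint), and it elaborates with this file. -/

@[closes "route-ABC-LopsidedSzpiroSplit"] theorem closes (hL : LopsidedABC) (hS : SexticABC) : _root_.ABC := by
  -- Deciding theorem (D-0027 §2.1): δ := min ε 1, K := max K₁ (2K₂+1); case split on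
  -- `min(a,b) ≤ c^(1-δ)` (lopsided: hL) vs the balanced complement, where
  -- `c^(6-δ)/2 < a·b·c⁴ < K₂·rad^(6+δ)` (hS) and `(1+δ)(6-δ) ≥ 6+δ` give the contradiction.
  suffices hA : Assembly from hA hL hS
  intro hL hS
  rw [_root_.ABC_iff]
  intro ε hε
  set δ : ℝ := min ε 1 with hδdef
  have hδ : 0 < δ := lt_min hε one_pos
  have hδ1 : δ ≤ 1 := min_le_right _ _
  have hδε : δ ≤ ε := min_le_left _ _
  obtain ⟨K1, hK1, h1⟩ := hL δ hδ
  obtain ⟨K2, hK2, h2⟩ := hS δ hδ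
  refine ⟨max K1 (2 * K2 + 1), lt_max_of_lt_left hK1, ?_⟩
  intro a b c habc
  obtain ⟨ha, hb, hab, hcop⟩ := habc
  have hcpos : 0 < c := by omega
  have hc : (0 : ℝ) < (c : ℝ) := by exact_mod_cast hcpos
  have hradne : Literature.NumberTheory.DiophantineGeometry.rad a b c ≠ 0 := by
    rw [Literature.NumberTheory.DiophantineGeometry.rad_def]
    exact UniqueFactorizationMonoid.radical_ne_zero
  have hR1 : (1 : ℝ) ≤ ((Literature.NumberTheory.DiophantineGeometry.rad a b c : ℕ) : ℝ) := by
    exact_mod_cast Nat.one_le_iff_ne_zero.mpr hradne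
  have hR0 : (0 : ℝ) < ((Literature.NumberTheory.DiophantineGeometry.rad a b c : ℕ) : ℝ) :=
    lt_of_lt_of_le one_pos hR1
  set R : ℝ := ((Literature.NumberTheory.DiophantineGeometry.rad a b c : ℕ) : ℝ) with hRdef
  have hRδε : R ^ (1 + δ) ≤ R ^ (1 + ε) :=
    Real.rpow_le_rpow_of_exponent_le hR1 (by linarith)
  have hC1 : K1 ≤ max K1 (2 * K2 + 1) := le_max_left _ _
  have hC2 : 2 * K2 + 1 ≤ max K1 (2 * K2 + 1) := le_max_right _ _
  by_cases hcase : ((min a b : ℕ) : ℝ) ≤ (c : ℝ) ^ (1 - δ)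
  · -- lopsided case
    have := h1 a b c ⟨ha, hb, hab, hcop⟩ hcase
    calc (c : ℝ) < K1 * R ^ (1 + δ) := this
      _ ≤ K1 * R ^ (1 + ε) := by gcongr
      _ ≤ max K1 (2 * K2 + 1) * R ^ (1 + ε) := by gcongr
  · -- balanced case: use SexticABC
    push Not at hcase
    have hmM : min a b * max a b = a * b := min_mul_max a b
    have hmle : min a b ≤ max a b := min_le_max
    have h2M : c ≤ 2 * max a b := by omega
    have hmM' : ((min a b : ℕ) : ℝ) * ((max a b : ℕ) : ℝ) = (a : ℝ) * (b : ℝ) := by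
      exact_mod_cast hmM
    have h2M' : (c : ℝ) ≤ 2 * ((max a b : ℕ) : ℝ) := by exact_mod_cast h2M
    have hS' := h2 a b c ⟨ha, hb, hab, hcop⟩
    have hcast : ((a * b * c ^ 4 : ℕ) : ℝ) = (a : ℝ) * (b : ℝ) * (c : ℝ) ^ (4 : ℕ) := by
      push_cast; ring
    rw [hcast] at hS'
    have hpow : (c : ℝ) ^ (6 - δ) = (c : ℝ) ^ (1 - δ) * (c : ℝ) * (c : ℝ) ^ (4 : ℕ) := by
      rw [← Real.rpow_natCast (c : ℝ) 4]
      rw [show (6 : ℝ) - δ = (1 - δ) + 1 + (4 : ℕ) by push_cast; ring]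
      rw [Real.rpow_add hc, Real.rpow_add hc, Real.rpow_one]
    have hlow : (c : ℝ) ^ (6 - δ) < 2 * ((a : ℝ) * (b : ℝ) * (c : ℝ) ^ (4 : ℕ)) := by
      rw [hpow, ← hmM']
      have hc4 : (0 : ℝ) < (c : ℝ) ^ (4 : ℕ) := by positivity
      have hcδ : (0 : ℝ) < (c : ℝ) ^ (1 - δ) := Real.rpow_pos_of_pos hc _
      have hMpos : (0 : ℝ) < ((max a b : ℕ) : ℝ) := by
        have : 0 < max a b := lt_of_lt_of_le ha (le_max_left a b)
        exact_mod_cast this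
      have hstep1 : (c : ℝ) ^ (1 - δ) * (c : ℝ) ≤ (c : ℝ) ^ (1 - δ) * (2 * ((max a b : ℕ) : ℝ)) :=
        mul_le_mul_of_nonneg_left h2M' hcδ.le
      have hstep2 : (c : ℝ) ^ (1 - δ) * (2 * ((max a b : ℕ) : ℝ))
          < ((min a b : ℕ) : ℝ) * (2 * ((max a b : ℕ) : ℝ)) :=
        mul_lt_mul_of_pos_right hcase (by positivity)
      have hstep3 : (c : ℝ) ^ (1 - δ) * (c : ℝ) < ((min a b : ℕ) : ℝ) * (2 * ((max a b : ℕ) : ℝ)) :=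
        lt_of_le_of_lt hstep1 hstep2
      have hstep4 := mul_lt_mul_of_pos_right hstep3 hc4
      calc (c : ℝ) ^ (1 - δ) * (c : ℝ) * (c : ℝ) ^ (4 : ℕ)
          < ((min a b : ℕ) : ℝ) * (2 * ((max a b : ℕ) : ℝ)) * (c : ℝ) ^ (4 : ℕ) := hstep4
        _ = 2 * (((min a b : ℕ) : ℝ) * ((max a b : ℕ) : ℝ) * (c : ℝ) ^ (4 : ℕ)) := by ring
    have hkey : (c : ℝ) ^ (6 - δ) < 2 * K2 * R ^ (6 + δ) := by nlinarith [hlow, hS']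
    by_contra hnot
    push Not at hnot
    set C' : ℝ := 2 * K2 + 1 with hC'def
    have hC'1 : (1 : ℝ) ≤ C' := by linarith
    have hC'0 : (0 : ℝ) ≤ C' := by linarith
    have hstep : C' * R ^ (1 + δ) ≤ (c : ℝ) := by
      calc C' * R ^ (1 + δ) ≤ max K1 (2 * K2 + 1) * R ^ (1 + ε) := by
            gcongr
        _ ≤ (c : ℝ) := hnot
    have hbase0 : (0 : ℝ) ≤ C' * R ^ (1 + δ) := by positivity
    have hraise : (C' * R ^ (1 + δ)) ^ (6 - δ) ≤ (c : ℝ) ^ (6 - δ) :=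
      Real.rpow_le_rpow hbase0 hstep (by linarith)
    have hsplit : (C' * R ^ (1 + δ)) ^ (6 - δ) = C' ^ (6 - δ) * R ^ ((1 + δ) * (6 - δ)) := by
      rw [Real.mul_rpow hC'0 (le_of_lt (Real.rpow_pos_of_pos hR0 _)), ← Real.rpow_mul (le_of_lt hR0)]
    have hCpow : C' ≤ C' ^ (6 - δ) := by
      calc C' = C' ^ (1 : ℝ) := (Real.rpow_one _).symm
        _ ≤ C' ^ (6 - δ) := Real.rpow_le_rpow_of_exponent_le hC'1 (by linarith)
    have hRpow : R ^ (6 + δ) ≤ R ^ ((1 + δ) * (6 - δ)) := by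
      apply Real.rpow_le_rpow_of_exponent_le hR1
      nlinarith
    have hR6 : (0 : ℝ) < R ^ (6 + δ) := Real.rpow_pos_of_pos hR0 _
    have hfin : C' * R ^ (6 + δ) ≤ (c : ℝ) ^ (6 - δ) := by
      calc C' * R ^ (6 + δ) ≤ C' ^ (6 - δ) * R ^ ((1 + δ) * (6 - δ)) := by
            gcongr
        _ = (C' * R ^ (1 + δ)) ^ (6 - δ) := hsplit.symm
        _ ≤ (c : ℝ) ^ (6 - δ) := hraise
    have hfin' : (2 * K2 + 1) * R ^ (6 + δ) ≤ (c : ℝ) ^ (6 - δ) := hfin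
    nlinarith [hkey, hfin', hR6]

end Summit.ABC.ABC.Theses.LopsidedSzpiroSplit
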